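import Mathlib
import HarnessLib
import Summits.Ventures.LatticeQCDFlow.Scoring.MarkovChainCLTCoverage
import Summits.Ventures.LatticeQCDFlow.Scoring.RestartChainRegenerative

/-!
# Non-equilibrium evolutions restarted from a prior chain: TIME AVERAGES of a record observable
# along the restart chain are asymptotically normal with the restart-law variance, from any start

HONEST FRAMING: exact (Metropolis-corrected) sampling algorithms for lattice gauge theory;
figures of merit are autocorrelation/cost numbers at stated couplings and volumes; no
continuum-physics claim.

Venture `LatticeQCDFlow` (cell pub-lqcd), topic `Scoring`; FANOUT row 8 (`s0-cpn-nemc`, GEN-18 —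
the row's own protocol: non-equilibrium evolutions started every `n_between` sweeps of an
equilibrium prior chain; Bonanno–Nada–Vadacchino 2024 NAMED ONLY).  NEW WORK of the cell, not a
published result; no definition is introduced.  Setting of `Scoring/RestartChainRegenerative.lean`:
prior sweep `κ₀` with invariant `π₀` and Doeblin constant `ε₀`, record kernel `κF`, restart chain
`K = prodMkRight κ₀ ⊗ₖ prodMkLeft κF` (invariant law `Π = π₀ ⊗ₘ κF`, Doeblin constant `ε₀` by
`Scoring/RestartTimeAverage.restart_doeblin`), `G` a bounded measurable record observable (e.g. a
truncated Jarzynski weight), `σ²_G` its Green–Kubo variance along `K`, which the RESTART LAW writes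
as `Var_Π G + 2 Σ_{k≥1} C^{κ₀}_h(k)`, `h = E[G | start]`.  By `Scoring/MarkovChainCLT.lean`: from
ANY initial law of the restart chain, the plain time average `Ḡ_n = (1/n) Σ_{t<n} G(x_t, ω_t)` of
`n` consecutive non-equilibrium records satisfies `√n (Ḡ_n − Π G) ⇒ N(0, σ²_G)`, and the coverage of
`Ḡ_n ± r/√n` converges to the Gaussian value: the `τ_int`-type error bar of the NE-MCMC average is
asymptotically exact, with a variance governed by the prior sweep's autocorrelation of the
conditional mean weight.  Printed counterpart NAMED ONLY: Meyn–Tweedie 1993 Thm 17.0.1 — nothing is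
cited as a fact.

## Content (`e = ε₀.toReal`; hypotheses of `Scoring.restart_regenerative_confidence_sigma`)

* **`restart_timeAverage_clt`** — for any `Y` with law `N(0, σ²_G)` and any initial law `μ₀`:
  `(√n)⁻¹ Σ_{t<n} (G(x_t) − Π G) ⇒ Y`;
* **`restart_timeAverage_coverage`** — `r > 0`: `P_{μ₀}(|√n (Ḡ_n − Π G)| ≤ r) → N(0, σ²_G)([−r, r])`.

NOT CLAIMED: any `ε₀` of a concrete sweep; rates; unbounded weights.
-/

noncomputable section

namespace Summit.Ventures.LatticeQCDFlow.Scoring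

open MeasureTheory ProbabilityTheory Filter Finset Preorder
open Literature.Probability.MarkovChains
open scoped ENNReal Topology

variable {Ω E : Type*} [MeasurableSpace Ω] [MeasurableSpace E]

section Restart

variable {κ₀ : Kernel Ω Ω} [IsMarkovKernel κ₀] {κF : Kernel Ω E} [IsMarkovKernel κF]
  {π₀ : Measure Ω} [IsProbabilityMeasure π₀] {ε : ℝ≥0∞}

/-- **CLT FOR TIME AVERAGES OF A RECORD OBSERVABLE ALONG THE RESTART CHAIN**, any initial law. -/
theorem restart_timeAverage_clt (hπ₀ : Kernel.Invariant κ₀ π₀)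
    (hmin : ∀ x {B : Set Ω}, MeasurableSet B → ε * π₀ B ≤ κ₀ x B) (hε0 : 0 < ε) (hε : ε < 1)
    {G : Ω × E → ℝ} (hG : Measurable G) {C : ℝ} (hC : ∀ p, |G p| ≤ C)
    (μ₀ : Measure (Ω × E)) [IsProbabilityMeasure μ₀]
    {Ω' : Type*} [MeasurableSpace Ω'] {P' : Measure Ω'} [IsProbabilityMeasure P'] {Y : Ω' → ℝ}
    (hY : HasLaw Y (gaussianReal 0 (Real.toNNReal ((∫ p, (G p - ∫ p', G p' ∂(π₀ ⊗ₘ κF)) ^ 2 ∂(π₀ ⊗ₘ κF))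
          + 2 * ∑' k, ∫ p, (G p - ∫ p', G p' ∂(π₀ ⊗ₘ κF))
            * (kop ((Kernel.prodMkRight E κ₀) ⊗ₖ (Kernel.prodMkLeft (Ω × E) κF)))^[k + 1]
              (fun p => G p - ∫ p', G p' ∂(π₀ ⊗ₘ κF)) p ∂(π₀ ⊗ₘ κF)))) P')
    [IsProbabilityMeasure (Kernel.trajMeasure (X := fun _ : ℕ => Ω × E) μ₀
        (fun n : ℕ => ((Kernel.prodMkRight E κ₀) ⊗ₖ (Kernel.prodMkLeft (Ω × E) κF)).comap
          (fun h : (i : ↥(Finset.Iic n)) → Ω × E => h ⟨n, Finset.mem_Iic.2 le_rfl⟩) (measurable_pi_apply _)))] :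
    TendstoInDistribution (fun (n : ℕ) (x : ℕ → Ω × E) => (Real.sqrt n)⁻¹ * ∑ t ∈ Finset.range n, (G (x t) - ∫ p, G p ∂(π₀ ⊗ₘ κF)))
      atTop Y (fun _ => (Kernel.trajMeasure (X := fun _ : ℕ => Ω × E) μ₀
        (fun n : ℕ => ((Kernel.prodMkRight E κ₀) ⊗ₖ (Kernel.prodMkLeft (Ω × E) κF)).comap
          (fun h : (i : ↥(Finset.Iic n)) → Ω × E => h ⟨n, Finset.mem_Iic.2 le_rfl⟩) (measurable_pi_apply _)))) P' :=
  markovChain_clt (κ := ((Kernel.prodMkRight E κ₀) ⊗ₖ (Kernel.prodMkLeft (Ω × E) κF))) (ν := π₀ ⊗ₘ κF) (invariant_restart hπ₀)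
    (fun p _ hS => restart_doeblin (κF := κF) hmin p hS) hε0 hε hG hC μ₀ hY

/-- **Coverage probabilities of the NE-MCMC time average converge to Gaussian values**, any start. -/
theorem restart_timeAverage_coverage (hπ₀ : Kernel.Invariant κ₀ π₀)
    (hmin : ∀ x {B : Set Ω}, MeasurableSet B → ε * π₀ B ≤ κ₀ x B) (hε0 : 0 < ε) (hε : ε < 1)
    {G : Ω × E → ℝ} (hG : Measurable G) {C : ℝ} (hC : ∀ p, |G p| ≤ C)
    (μ₀ : Measure (Ω × E)) [IsProbabilityMeasure μ₀] {r : ℝ} (hr : 0 < r) :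
    Tendsto (fun n : ℕ => (Kernel.trajMeasure (X := fun _ : ℕ => Ω × E) μ₀
        (fun n : ℕ => ((Kernel.prodMkRight E κ₀) ⊗ₖ (Kernel.prodMkLeft (Ω × E) κF)).comap
          (fun h : (i : ↥(Finset.Iic n)) → Ω × E => h ⟨n, Finset.mem_Iic.2 le_rfl⟩) (measurable_pi_apply _))).real
      {x | |(Real.sqrt n)⁻¹ * ∑ t ∈ Finset.range n, (G (x t) - ∫ p, G p ∂(π₀ ⊗ₘ κF))| ≤ r})
      atTop (𝓝 ((gaussianReal 0 (Real.toNNReal ((∫ p, (G p - ∫ p', G p' ∂(π₀ ⊗ₘ κF)) ^ 2 ∂(π₀ ⊗ₘ κF))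
          + 2 * ∑' k, ∫ p, (G p - ∫ p', G p' ∂(π₀ ⊗ₘ κF))
            * (kop ((Kernel.prodMkRight E κ₀) ⊗ₖ (Kernel.prodMkLeft (Ω × E) κF)))^[k + 1]
              (fun p => G p - ∫ p', G p' ∂(π₀ ⊗ₘ κF)) p ∂(π₀ ⊗ₘ κF)))).real (Set.Icc (-r) r))) :=
  markovChain_clt_coverage (κ := ((Kernel.prodMkRight E κ₀) ⊗ₖ (Kernel.prodMkLeft (Ω × E) κF))) (ν := π₀ ⊗ₘ κF) (invariant_restart hπ₀)
    (fun p _ hS => restart_doeblin (κF := κF) hmin p hS) hε0 hε hG hC μ₀ hr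

end Restart

end Summit.Ventures.LatticeQCDFlow.Scoring

end
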